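import Literature.Topology.FourManifolds.BordismFourBoundaryClass
import Literature.AlgebraicTopology.SingularHomology.BoundaryManifoldFiniteness
import Literature.AlgebraicTopology.SingularHomology.CohomologyFiniteness
import HarnessLib

/-!
# `isOrientedBordant_iff_signature_eq` from duality and Thom IV.13 alone
(Layer 7 of `Literature.Topology.FourManifolds.isOrientedBordant_iff_signature_eq`)

Sibling proof file of `Literature.Topology.FourManifolds.BordismFourBoundaryClass`.  There
spc4.S36 (two closed oriented smooth 4-manifolds are oriented bordant iff their signatures agree;
Thom 1954, Thm IV.1 + Thm IV.13) was proved from seven named facts.  Four of them are now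
theorems of `Literature`:

* `hFW` — Spanier Cor. 6.2.21, finite generation of `H₂(W; ℤ)` (and `H₂(W, ∂W; ℤ)`) for a compact
  5-manifold with boundary carrying a fundamental class:
  `finite_singularHomology_of_isRelFundamentalClass_holds` (`…BoundaryManifoldFiniteness`,
  Wilder's method);
* `hF₂`, `hF₁` — Hatcher Cor. A.8–A.9, finite generation of `H₂`, `H₁` of closed 4-manifolds:
  `finite_singularHomology_of_compactSpace_holds` (`…CompactManifoldFiniteness`);
* `hF2` — the same for `H²`: `finite_singularCohomology_of_compactSpace_of_isPrincipalIdealRing`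
  (`…CohomologyFiniteness`, over the PID `ℤ`).

What remains: Lefschetz duality for compact 5-manifolds with boundary (`hL`, Spanier
Thm. 6.3.12), Poincaré duality for closed 4-manifolds (`hD`, Hatcher Thm. 3.30), and — for the
converse direction only — Thom's Thm IV.13 (`h₂`, `Ω⁴ ≅ ℤ` detected by the signature).

* `two_mul_boundaryImageRank_eq_of_duality'` — Thom 1952 Cor. V.8 (`n = 4`, `p = 2`) from `hL`,
  `hD`;
* `signature_eq_of_isOrientedBordant_of_duality''` — **Thom's Thm IV.1 in dimension four from
  Lefschetz and Poincaré duality alone**;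
* `isOrientedBordant_iff_signature_eq_of_duality''` — spc4.S36 from `hL`, `hD`, `h₂`.
  REMAINING HYPOTHESES: 3.

## References

* R. Thom, *Quelques propriétés globales des variétés différentiables*, Comment. Math. Helv. 28
  (1954), Thm IV.1 (p. 65), Thm IV.13 (p. 81). [ThomCMH1954]
* R. Thom, *Espaces fibrés en sphères et carrés de Steenrod*, Ann. Sci. ENS 69 (1952), Cor. V.8
  (p. 173). [Thom1952]
* A. Hatcher, *Algebraic Topology*, CUP 2002, Thm. 3.30, Cor. A.8–A.9, §3.1 Cor. 3.3. [Hatcher2002]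
* E. H. Spanier, *Algebraic Topology*, Springer 1981, Ch. 6 §2 Cor. 21, §3 Thm. 12. [Spanier1981]
-/

noncomputable section

open scoped Manifold ContDiff Topology

universe u

namespace Literature.Topology.FourManifolds

section SPC4

/-- **The leaf `two_mul_boundaryImageRank_eq` (Thom 1952, Cor. V.8 for `n = 4`, `p = 2`) from
Lefschetz duality (`hL`, Spanier Thm. 6.3.12) and Poincaré duality (`hD`, Hatcher Thm. 3.30)
alone**: all finiteness inputs (Spanier Cor. 6.2.21 for the compact 5-manifold with boundary,
Hatcher Cor. A.8–A.9 with Cor. 3.3 for the closed ends) are theorems.  PROVED.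
[cite: Thom1952, Cor. V.8 (p. 173)] -/
theorem two_mul_boundaryImageRank_eq_of_duality'
    (hL : ∀ {W : Type u} [TopologicalSpace W] [T2Space W] [CompactSpace W]
      [ChartedSpace (EuclideanHalfSpace (4 + 1)) W]
      (z : ↥(Literature.AlgebraicTopology.SingularHomology.relativeSingularHomology ℤ ℤ W ((𝓡∂ (4 + 1)).boundary W) (4 + 1)))
      (hz : Literature.AlgebraicTopology.SingularHomology.IsRelFundamentalClass ℤ ((𝓡∂ (4 + 1)).boundary W) z),
      Literature.AlgebraicTopology.SingularHomology.bijective_relCapProduct_of_isRelFundamentalClass ℤ 4 W z hz (show 2 + (2 + 1) = 4 + 1 by rfl))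
    (hD : ∀ {P : Type u} [TopologicalSpace P] [T2Space P] [CompactSpace P]
      [ChartedSpace (EuclideanSpace ℝ (Fin 4)) P] (π : Literature.AlgebraicTopology.SingularHomology.HomologicalOrientation ℤ P 4),
      Literature.AlgebraicTopology.SingularHomology.bijective_poincareDualityMap π two_add_two_eq_four) :
    two_mul_boundaryImageRank_eq.{u} :=
  two_mul_boundaryImageRank_eq_of_duality hL
    (fun {W} _ _ _ _ z hz =>
      Literature.AlgebraicTopology.SingularHomology.finite_singularHomology_of_isRelFundamentalClass_holds 4 W z hz 2)
    hD
    (fun {P} _ _ _ _ =>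
      Literature.AlgebraicTopology.SingularHomology.finite_singularCohomology_of_compactSpace_of_isPrincipalIdealRing ℤ P 4 2)
    (fun {P} _ _ _ _ =>
      Literature.AlgebraicTopology.SingularHomology.finite_singularHomology_of_compactSpace_holds ℤ P 4 2)
    (fun {P} _ _ _ _ =>
      Literature.AlgebraicTopology.SingularHomology.finite_singularHomology_of_compactSpace_holds ℤ P 4 1)

/-- **Thom's Thm IV.1 in dimension four (bordism invariance of the signature) from Lefschetz and
Poincaré duality alone** (`hL`, Spanier Thm. 6.3.12; `hD`, Hatcher Thm. 3.30): if two closed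
oriented smooth 4-manifolds are oriented bordant, their signatures agree.  Universal
coefficients, graded commutativity of `⌣`, fundamental classes, the normalization of homological
bordism data, all finiteness statements, the duality ladder, the isotropy of `A²` and Sylvester's
law are theorems of `Literature`.  PROVED. [cite: ThomCMH1954, Thm IV.1 (p. 65)] -/
theorem signature_eq_of_isOrientedBordant_of_duality''
    (hL : ∀ {W : Type u} [TopologicalSpace W] [T2Space W] [CompactSpace W]
      [ChartedSpace (EuclideanHalfSpace (4 + 1)) W]
      (z : ↥(Literature.AlgebraicTopology.SingularHomology.relativeSingularHomology ℤ ℤ W ((𝓡∂ (4 + 1)).boundary W) (4 + 1)))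
      (hz : Literature.AlgebraicTopology.SingularHomology.IsRelFundamentalClass ℤ ((𝓡∂ (4 + 1)).boundary W) z),
      Literature.AlgebraicTopology.SingularHomology.bijective_relCapProduct_of_isRelFundamentalClass ℤ 4 W z hz (show 2 + (2 + 1) = 4 + 1 by rfl))
    (hD : ∀ {P : Type u} [TopologicalSpace P] [T2Space P] [CompactSpace P]
      [ChartedSpace (EuclideanSpace ℝ (Fin 4)) P] (π : Literature.AlgebraicTopology.SingularHomology.HomologicalOrientation ℤ P 4),
      Literature.AlgebraicTopology.SingularHomology.bijective_poincareDualityMap π two_add_two_eq_four) :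
    signature_eq_of_isOrientedBordant.{u} :=
  signature_eq_of_isOrientedBordant_of_duality' hL
    (fun {W} _ _ _ _ z hz =>
      Literature.AlgebraicTopology.SingularHomology.finite_singularHomology_of_isRelFundamentalClass_holds 4 W z hz 2)
    hD
    (fun {P} _ _ _ _ =>
      Literature.AlgebraicTopology.SingularHomology.finite_singularCohomology_of_compactSpace_of_isPrincipalIdealRing ℤ P 4 2)
    (fun {P} _ _ _ _ =>
      Literature.AlgebraicTopology.SingularHomology.finite_singularHomology_of_compactSpace_holds ℤ P 4 2)
    (fun {P} _ _ _ _ =>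
      Literature.AlgebraicTopology.SingularHomology.finite_singularHomology_of_compactSpace_holds ℤ P 4 1)

/-- **spc4.S36 (`isOrientedBordant_iff_signature_eq`) from Lefschetz duality, Poincaré duality and
Thom's Thm IV.13** — three inputs: `hL` (Spanier Thm. 6.3.12, compact 5-manifolds with
boundary), `hD` (Hatcher Thm. 3.30, closed 4-manifolds), `h₂` (`Ω⁴ ≅ ℤ` detected by the
signature — the converse direction).  PROVED.
[cite: ThomCMH1954, Thm IV.1 (p. 65) and Thm IV.13 (p. 81)] -/
theorem isOrientedBordant_iff_signature_eq_of_duality''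
    (hL : ∀ {W : Type u} [TopologicalSpace W] [T2Space W] [CompactSpace W]
      [ChartedSpace (EuclideanHalfSpace (4 + 1)) W]
      (z : ↥(Literature.AlgebraicTopology.SingularHomology.relativeSingularHomology ℤ ℤ W ((𝓡∂ (4 + 1)).boundary W) (4 + 1)))
      (hz : Literature.AlgebraicTopology.SingularHomology.IsRelFundamentalClass ℤ ((𝓡∂ (4 + 1)).boundary W) z),
      Literature.AlgebraicTopology.SingularHomology.bijective_relCapProduct_of_isRelFundamentalClass ℤ 4 W z hz (show 2 + (2 + 1) = 4 + 1 by rfl))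
    (hD : ∀ {P : Type u} [TopologicalSpace P] [T2Space P] [CompactSpace P]
      [ChartedSpace (EuclideanSpace ℝ (Fin 4)) P] (π : Literature.AlgebraicTopology.SingularHomology.HomologicalOrientation ℤ P 4),
      Literature.AlgebraicTopology.SingularHomology.bijective_poincareDualityMap π two_add_two_eq_four)
    (h₂ : isOrientedBordant_of_signature_eq.{u}) : isOrientedBordant_iff_signature_eq.{u} :=
  isOrientedBordant_iff_signature_eq_of (signature_eq_of_isOrientedBordant_of_duality'' hL hD) h₂

end SPC4

end Literature.Topology.FourManifolds

end
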